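import Summits.RiemannHypothesis.RiemannHypothesis.Theorems.TiltedLandingLaw421R3Lens1TwoBody

/-!
# Two-body foot chord THROUGH THE HEIGHT WALL — the rung's `y < 1` is the NoTallerToucher wall (LENS-1 gen 9, supplement to W)

LENS-1 gen-9 module image `rh33346-cover/lens-1/TwoBodyWall-v1.lean` (landing target
`Summits/RiemannHypothesis/RiemannHypothesis/Theorems/TiltedLandingLaw421R3Lens1TwoBodyWall.lean`; ONE import, the landed W
`…R3Lens1TwoBody`; namespace `RhW08.Lens1TwoBody` reopened; nothing re-declared).

W proves `chordEnd_re_lt_foot`: for a mate `m = x + iy` with `0 < y < 1`, `0 < x`, `|m| > 1`, every zero `θ ∈ (0, π/2)` of the two-body circle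
data ends a chord strictly BELOW the foot value.  This file certifies that the height hypothesis `y < 1` is load-bearing and that it is exactly the
`NoTallerToucher` wall `y = Im a` of `TopPinning`: for the taller touching mate `m = 4/5 + 11i/10` the foot chord `[0, θ*]`, `cos θ* = 43/160`,
exists, the circle data is positive on `(0, θ*)`, and the chord ASCENDS, `Re φ(1) = 33/25 < 160/43 − 160/85 = Re φ(e^{iθ*})` (C6 RESULT-5b's
exact row, slack −0.519, as a theorem).  So `(R1)` is false without `y < 1`, in the rung's own terms.

Nothing here bears on the truth of RH; `(T)`, `(S)`, `TopPinning`, 33346/33347 remain OPEN.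
-/

open Complex

noncomputable section

namespace RhW08.Lens1TwoBody

/-! §1 The wall witness
The height hypothesis `y < 1` of the rung is load-bearing and sits at the NoTallerToucher wall `y = Im a` (C6 RESULT-5b, exact numerics):
for the mate `m = 4/5 + 11i/10` — taller than `a = i` and touching it, i.e. violating `NoTallerToucher` — the foot chord exists, the circle data
is positive on `(0, θ*)` with `cos θ* = 43/160`, and the chord ASCENDS: `Re φ(1) = 33/25 < Re φ(e^{iθ*}) = 160/43 − 160/85`. -/

/-- `(R1)_false_without_(y < 1)`: a taller touching mate makes the two-body foot chord ASCEND (explicit witness `x = 4/5`, `y = 11/10`,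
`θ* = arccos (43/160)`). -/
theorem footChord_ascends_above_wall : ∃ x y θ : ℝ, 0 < x ∧ 1 < y ∧ 1 < x ^ 2 + y ^ 2 ∧ 0 < θ ∧ θ < Real.pi / 2 ∧
    hM x y θ = 0 ∧ (∀ θ' ∈ Set.Ioo 0 θ, 0 < hM x y θ') ∧ (phiM x y 1).re < (phiM x y (cexp (θ * I))).re := by
  have hs : (1 : ℝ) < (4 / 5) ^ 2 + (11 / 10) ^ 2 := by norm_num
  have hc : Real.cos (Real.arccos (43 / 160)) = 43 / 160 := Real.cos_arccos (by norm_num) (by norm_num)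
  have hθ0 : 0 < Real.arccos (43 / 160) := Real.arccos_pos.2 (by norm_num)
  have hθ1 : Real.arccos (43 / 160) < Real.pi / 2 := by rw [Real.arccos_lt_pi_div_two]; norm_num
  have pyth : Real.cos (Real.arccos (43 / 160)) ^ 2 + Real.sin (Real.arccos (43 / 160)) ^ 2 = 1 := Real.cos_sq_add_sin_sq _
  have K0 : 1 - 2 * (4 / 5 : ℝ) * Real.cos (Real.arccos (43 / 160)) + (4 / 5) ^ 2 - (11 / 10) ^ 2 = 0 := by rw [hc]; norm_num
  refine ⟨4 / 5, 11 / 10, Real.arccos (43 / 160), by norm_num, by norm_num, hs, hθ0, hθ1, ?_, ?_, ?_⟩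
  · rw [hM_formula _ _ _ hs,
      show (Real.cos (Real.arccos (43 / 160)) - 4 / 5) ^ 2 + Real.sin (Real.arccos (43 / 160)) ^ 2 - (11 / 10) ^ 2 = 0 by
        linear_combination pyth - (8 / 5) * hc]
    simp
  · intro θ' hθ'
    have hθ'π : θ' < Real.pi := by linarith [hθ'.2, Real.pi_pos]
    rw [hM_pos_iff _ _ _ hs hθ'.1 hθ'π]
    have : Real.cos (Real.arccos (43 / 160)) < Real.cos θ' := Real.cos_lt_cos_of_nonneg_of_le_pi hθ'.1.le (by linarith) hθ'.2
    rw [hc] at this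
    linarith
  · have hre : (phiM (4 / 5) (11 / 10) (cexp (Real.arccos (43 / 160) * I))).re =
        1 / Real.cos (Real.arccos (43 / 160)) + 1 / (Real.cos (Real.arccos (43 / 160)) - 4 / 5) := by
      simp only [phiM, cexp_mul_I_eq, Complex.add_re, pair_re_circle _ _ pyth (by rw [hc]; norm_num)]
      rw [add_assoc, matePair_re_collapse (4 / 5) (11 / 10) _ _ pyth hs (by norm_num) K0]
    rw [hre, phiM_re_one, hc]
    norm_num

end RhW08.Lens1TwoBody

end
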